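import Summits.CriticalPhenomena.CardyFormulaZ2.Theorems.CardyComplexConeParafermionToSLESixFamiliesDiamondDefs
import Summits.CriticalPhenomena.CardyFormulaZ2.Theorems.CardyComplexConeParafermionToSLESixFamiliesDiamondVertexRelationArcAOnceTwice
import Summits.CriticalPhenomena.CardyFormulaZ2.Theorems.CardyComplexConeParafermionToSLESixFamiliesDiamondVertexRelationArcASpliceLoop
import Summits.CriticalPhenomena.CardyFormulaZ2.Theorems.CardyComplexConeEdgePrecompactVertexRelation
import HarnessLib

/-!
# The vertex relation at interior–wired-arc edges (`stub_vertexRelationArcA`, S1v)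
(line `potential-darboux-picard-diamond` of crux `ParafermionToSLESixFamilies`, stmt-CriticalPhenomena-11389;
closing file of the stub: `VertexRelationArcA` of `…DiamondDefs.lean`)

`VertexRelationArcA` is verbatim the landed `q = 1` half-Cauchy–Riemann vertex relation `cornerObs_vertexRelation`
(`…EdgePrecompactVertexRelation.lean`: Jordan carrier, admissible datum, `e = cTgt p` an edge of `Ω_δ`, both
faces of `e` inner, `E(oX) − E(oY) = i (E(p₂) − E(p))`) EXCEPT that "both endpoints of `e` off both arcs" is
weakened to "no endpoint on the free arc `B`, not both on the wired arc `A`": `e` is still a fair coin of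
`bcBondConfig`, but one endpoint may be a wired-arc site. The tree's proof derives "all four faces around both
endpoints inner" (`forall_isInnerFace_of_not_mem_arcs`) and feeds it to the once/twice corner-orbit analysis
under `ω ↦ ω △ {e}`; that analysis uses it only for the two faces of `e`, for "the endpoints of `e` are off `B`"
(so a dart arriving at `e` is not the exit corner, the partner's loop cannot pivot around a `B`-site, and the
start corner is not a corner leaving `e`). The two helper files re-ran the once/twice bookkeeping
(`vertexRelation_onceTwice_arcA`, `pairSum_of_core_arcA`, on `cornerOrbit_toggle_case1_free` of the Literature)
and the planar input (`spliceLoop_turning_eq_arcA`) under these hypotheses; this file re-runs the case analysis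
of the pair identity (`pairSum_case1_arcA`, `pairSum_case2_arcA`, `vertexRelation_pairSum_arcA`), the pointwise
oddness of the defect under the `P_{1/2}`-preserving involution (`dartPhaseSum_pair_arcA`; the edge is a fair
coin because it is not an `A`–`A` edge and touches no `B`-site), integrates (`cornerObs_vertexRelation_arcA`,
`bondPercolation_half_map_symmDiff`), and reads off `stub_vertexRelationArcA`. Exact enumeration on `R = 3, 4`
diamonds (lead's scratch `latt.py` / `cenum.c`) found the defect of the relation `≤ 2·10⁻¹⁰` at such edges
(the same size as at interior edges; floating-point summation).

References: S. Smirnov, Ann. of Math. 172 (2010), proof of Lemma 4.5 and Remark 4.7 ("the only global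
information needed is that the graph is planar"); H. Duminil-Copin, S. Smirnov, arXiv:1109.1549, §8, Prop. 8.6;
H. Duminil-Copin, arXiv:1208.3787, Prop. 4.
-/

namespace Summit.CriticalPhenomena.CardyFormulaZ2.Cruxes.ParafermionToSLESixFamilies.PotentialDarbouxPicardDiamond

open MeasureTheory Filter Set Metric
open scoped Topology BigOperators Pointwise
open Literature.Probability.LatticeModels Literature.Probability.Percolation
open Literature.Probability.RandomPlanarGeometry (DobrushinDomain)
open Summit.CriticalPhenomena.CardyFormulaZ2.Theses.CardyComplexCone
open Summit.CriticalPhenomena.CardyFormulaZ2.Cruxes.EdgePrecompact.QkzStripBoundaryArm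

/-! ## The two cases of the pair identity -/

/-- **Case 1** (weak hypotheses): `d` is a dart of the path of `ω` and its partner is not. -/
theorem pairSum_case1_arcA : ∀ (φ : ℤ → ℂ), (∀ m n, φ (m + n) = φ m * φ n) → 2 * φ 1 - φ (-1) = Complex.I * (φ 2 - 2) → φ 1 - 2 * φ (-1) = Complex.I * (φ (-2) - 2) → ∀ (E : DiscreteDobrushin), E.IsZdAdmissible → ∀ (ω ω' : BondConfig (Site 2)) (c₀ d : Site 2 × Fin 4) (N N' i₁ : ℕ), E.IsStartCorner c₀ → (∀ e', e' ≠ cTgt d → (e' ∈ E.bcBondConfig ω' ↔ e' ∈ E.bcBondConfig ω)) → ¬ (cTgt d ∈ E.bcBondConfig ω' ↔ cTgt d ∈ E.bcBondConfig ω) → E.IsInnerFace (cFace (cornerPartner d)) → d.1 + cornerUnit (d.2 + 1) ∉ E.zdArcB → ¬ E.IsInnerFace (cFace (cornerOrbit (E.bcBondConfig ω) c₀ N)) → (∀ k < N, E.IsInnerFace (cFace (cornerOrbit (E.bcBondConfig ω) c₀ k))) → ¬ E.IsInnerFace (cFace (cornerOrbit (E.bcBondConfig ω') c₀ N')) → (∀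 k < N', E.IsInnerFace (cFace (cornerOrbit (E.bcBondConfig ω') c₀ k))) → cornerOrbit (E.bcBondConfig ω) c₀ i₁ = d → i₁ < N → (∀ i < N, cornerOrbit (E.bcBondConfig ω) c₀ i ≠ cornerPartner d) → (∀ (ω₁ : BondConfig (Site 2)) (N₁ i₁ Q : ℕ), ¬ E.IsInnerFace (cFace (cornerOrbit (E.bcBondConfig ω₁) c₀ N₁)) → (∀ k < N₁, E.IsInnerFace (cFace (cornerOrbit (E.bcBondConfig ω₁) c₀ k))) → cornerOrbit (E.bcBondConfig ω₁) c₀ i₁ = d → i₁ < N₁ → (∀ i < N₁, cornerOrbit (E.bcBondConfig ω₁) c₀ i ≠ cornerPartner d) → 0 < Q → cornerOrbit (E.bcBondConfig ω₁) (cornerPartner d) Q = cornerPartner d → (∀ s, 0 < s → s < Q → cornerOrbit (E.bcBondConfig ω₁) (cornerPartner d) s ≠ cornerPartner d) → ∑ m ∈ Finset.range Q, turnSign (E.bcBondConfig ω₁) (cornerOrbit (E.bcBondConfig ω₁) (cornerPartner d) m) = 4 * turnSign (E.bcBondConfig ω₁) d) → ((∑ j ∈ (Finset.range N).filter (fun j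 => cornerOrbit (E.bcBondConfig ω) c₀ j = (d.1, d.2 + 1)), φ (turnCount (E.bcBondConfig ω) c₀ j)) + (∑ j ∈ (Finset.range N').filter (fun j => cornerOrbit (E.bcBondConfig ω') c₀ j = (d.1, d.2 + 1)), φ (turnCount (E.bcBondConfig ω') c₀ j))) - ((∑ j ∈ (Finset.range N).filter (fun j => cornerOrbit (E.bcBondConfig ω) c₀ j = (d.1 + cornerUnit (d.2 + 1), d.2 + 3)), φ (turnCount (E.bcBondConfig ω) c₀ j)) + (∑ j ∈ (Finset.range N').filter (fun j => cornerOrbit (E.bcBondConfig ω') c₀ j = (d.1 + cornerUnit (d.2 + 1), d.2 + 3)), φ (turnCount (E.bcBondConfig ω') c₀ j))) - Complex.I * (((∑ j ∈ (Finset.range N).filter (fun j => cornerOrbit (E.bcBondConfig ω) c₀ j = cornerPartner d), φ (turnCount (E.bcBondConfig ω) c₀ j)) + (∑ j ∈ (Finset.range N').filter (fun j => cornerOrbit (E.bcBondConfig ω') c₀ j = cornerPartner d), φ (turnCount (E.bcBondConfig ω') c₀ j))) - ((∑ j ∈ (Finset.range N).filter (fun j => cornerOrbit (E.bcBondConfig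 ω) c₀ j = d), φ (turnCount (E.bcBondConfig ω) c₀ j)) + (∑ j ∈ (Finset.range N').filter (fun j => cornerOrbit (E.bcBondConfig ω') c₀ j = d), φ (turnCount (E.bcBondConfig ω') c₀ j)))) = 0 := by
  intro φ hφ hI1 hI2 E hE ω ω' c₀ d N N' i₁ hc₀ hagree hdiff hp₂f hyB hN hlt hN' hlt' hi₁ hi₁N h₂ hH
  have hmesh : (cornerPartner d).1 ∈ meshDomain E.Ω E.δ :=
    fst_mem_meshDomain_of_isInnerFace (q := cornerPartner d) hp₂f
  obtain ⟨Q, hQ0, hQ, hQmin⟩ := exists_min_period (exists_cornerOrbit_period (ω := ω) hE hmesh)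
  exact pairSum_of_core_arcA φ hφ hI1 hI2 E hE ω ω' c₀ d N N' i₁ Q hc₀ hagree hdiff hp₂f hyB hN hlt hN' hlt' hi₁ hi₁N
    h₂ hQ0 hQ hQmin (hH ω N i₁ Q hN hlt hi₁ hi₁N h₂ hQ0 hQ hQmin)

/-- **Case 2** (weak hypotheses): `d = orb i₁` and its partner `orb i₂` are both darts of the path of `ω`,
`d` first. Then `ω'` is the once-configuration (exit at `N − (i₂ − i₁)`), the loop through the partner under `ω'`
being the excised stretch `orb (i₁+1), …, orb i₂` (minimal period `i₂ − i₁`). -/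
theorem pairSum_case2_arcA : ∀ (φ : ℤ → ℂ), (∀ m n, φ (m + n) = φ m * φ n) → 2 * φ 1 - φ (-1) = Complex.I * (φ 2 - 2) → φ 1 - 2 * φ (-1) = Complex.I * (φ (-2) - 2) → ∀ (E : DiscreteDobrushin), E.IsZdAdmissible → ∀ (ω ω' : BondConfig (Site 2)) (c₀ d : Site 2 × Fin 4) (N N' i₁ i₂ : ℕ), E.IsStartCorner c₀ → (∀ e', e' ≠ cTgt d → (e' ∈ E.bcBondConfig ω' ↔ e' ∈ E.bcBondConfig ω)) → ¬ (cTgt d ∈ E.bcBondConfig ω' ↔ cTgt d ∈ E.bcBondConfig ω) → E.IsInnerFace (cFace (cornerPartner d)) → d.1 + cornerUnit (d.2 + 1) ∉ E.zdArcB → ¬ E.IsInnerFace (cFace (cornerOrbit (E.bcBondConfig ω) c₀ N)) → (∀ k < N, E.IsInnerFace (cFace (cornerOrbit (E.bcBondConfig ω) c₀ k))) → ¬ E.IsInnerFace (cFace (cornerOrbit (E.bcBondConfig ω') c₀ N')) → (∀ k < N', E.IsInnerFace (cFace (cornerOrbit (E.bcBondConfig ω') c₀ k))) → cornerOrbit (E.bcBondConfig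 ω) c₀ i₁ = d → cornerOrbit (E.bcBondConfig ω) c₀ i₂ = cornerPartner d → i₁ < i₂ → i₂ < N → (∀ (ω₁ : BondConfig (Site 2)) (N₁ i₁ Q : ℕ), ¬ E.IsInnerFace (cFace (cornerOrbit (E.bcBondConfig ω₁) c₀ N₁)) → (∀ k < N₁, E.IsInnerFace (cFace (cornerOrbit (E.bcBondConfig ω₁) c₀ k))) → cornerOrbit (E.bcBondConfig ω₁) c₀ i₁ = d → i₁ < N₁ → (∀ i < N₁, cornerOrbit (E.bcBondConfig ω₁) c₀ i ≠ cornerPartner d) → 0 < Q → cornerOrbit (E.bcBondConfig ω₁) (cornerPartner d) Q = cornerPartner d → (∀ s, 0 < s → s < Q → cornerOrbit (E.bcBondConfig ω₁) (cornerPartner d) s ≠ cornerPartner d) → ∑ m ∈ Finset.range Q, turnSign (E.bcBondConfig ω₁) (cornerOrbit (E.bcBondConfig ω₁) (cornerPartner d) m) = 4 * turnSign (E.bcBondConfig ω₁) d) → ((∑ j ∈ (Finset.range N).filter (fun j => cornerOrbit (E.bcBondConfig ω) c₀ j = (d.1, d.2 + 1)), φ (turnCount (E.bcBondConfig ω) c₀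 j)) + (∑ j ∈ (Finset.range N').filter (fun j => cornerOrbit (E.bcBondConfig ω') c₀ j = (d.1, d.2 + 1)), φ (turnCount (E.bcBondConfig ω') c₀ j))) - ((∑ j ∈ (Finset.range N).filter (fun j => cornerOrbit (E.bcBondConfig ω) c₀ j = (d.1 + cornerUnit (d.2 + 1), d.2 + 3)), φ (turnCount (E.bcBondConfig ω) c₀ j)) + (∑ j ∈ (Finset.range N').filter (fun j => cornerOrbit (E.bcBondConfig ω') c₀ j = (d.1 + cornerUnit (d.2 + 1), d.2 + 3)), φ (turnCount (E.bcBondConfig ω') c₀ j))) - Complex.I * (((∑ j ∈ (Finset.range N).filter (fun j => cornerOrbit (E.bcBondConfig ω) c₀ j = cornerPartner d), φ (turnCount (E.bcBondConfig ω) c₀ j)) + (∑ j ∈ (Finset.range N').filter (fun j => cornerOrbit (E.bcBondConfig ω') c₀ j = cornerPartner d), φ (turnCount (E.bcBondConfig ω') c₀ j))) - ((∑ j ∈ (Finset.range N).filter (fun j => cornerOrbit (E.bcBondConfig ω) c₀ j = d), φ (turnCount (E.bcBondConfig ω) c₀ j)) + (∑ j ∈ (Finset.range N').filter (fun j => cornerOrbit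 (E.bcBondConfig ω') c₀ j = d), φ (turnCount (E.bcBondConfig ω') c₀ j)))) = 0 := by
  intro φ hφ hI1 hI2 E hE ω ω' c₀ d N N' i₁ i₂ hc₀ hagree hdiff hp₂f hyB hN hlt hN' hlt' hi₁ hi₂ h12 hi₂N hH
  have hstep : ∀ (β : BondConfig (Site 2)) (c : Site 2 × Fin 4) (i : ℕ),
      cornerOrbit β c (i + 1) = nextCorner β (cornerOrbit β c i) := fun _ _ _ => rfl
  have hinj : ∀ a b, a < N → b < N → cornerOrbit (E.bcBondConfig ω) c₀ a = cornerOrbit (E.bcBondConfig ω) c₀ b → a = b := by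
    intro a b ha hb h
    by_contra hne
    rcases Nat.lt_or_gt_of_ne hne with hab | hab
    · exact cornerOrbit_ne hE hc₀ hab (fun k hk => hlt k (by omega)) h
    · exact cornerOrbit_ne hE hc₀ hab (fun k hk => hlt k (by omega)) h.symm
  obtain ⟨hpre, hshift⟩ := cornerOrbit_toggle_case2 hE hc₀ hagree hdiff hlt hi₁ hi₂ h12 hi₂N
  obtain ⟨hN'', hlt''⟩ := exit_toggle_case2 hE hc₀ hagree hdiff hN hlt hi₁ hi₂ h12 hi₂N
  obtain rfl : N' = N - (i₂ - i₁) := exit_unique hN' hlt' hN'' hlt''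
  -- the loop through the partner under `ω'`
  have hloop : ∀ j, j + 1 ≤ i₂ - i₁ →
      cornerOrbit (E.bcBondConfig ω') (cornerPartner d) (j + 1) = cornerOrbit (E.bcBondConfig ω) c₀ (i₁ + 1 + j) := by
    intro j hj
    induction j with
    | zero =>
      rw [hstep _ _ 0, cornerOrbit_zero', nextCorner_toggle hagree hdiff, Equiv.swap_apply_right, add_zero, hstep, hi₁]
    | succ j ih =>
      rw [show i₁ + 1 + (j + 1) = i₁ + 1 + j + 1 by omega, hstep _ _ (j + 1), hstep _ c₀ (i₁ + 1 + j), ih (by omega),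
        nextCorner_toggle_of_ne hagree hdiff]
      · intro h; have := hinj _ _ (by omega) (by omega) (h.trans hi₁.symm); omega
      · intro h; have := hinj _ _ (by omega) hi₂N (h.trans hi₂.symm); omega
  have hQ' : cornerOrbit (E.bcBondConfig ω') (cornerPartner d) (i₂ - i₁) = cornerPartner d := by
    have := hloop (i₂ - i₁ - 1) (by omega)
    rwa [show i₂ - i₁ - 1 + 1 = i₂ - i₁ by omega, show i₁ + 1 + (i₂ - i₁ - 1) = i₂ by omega, hi₂] at this
  have hQmin' : ∀ s, 0 < s → s < i₂ - i₁ → cornerOrbit (E.bcBondConfig ω') (cornerPartner d) s ≠ cornerPartner d := by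
    intro s hs hsQ h
    have := hloop (s - 1) (by omega)
    rw [show s - 1 + 1 = s by omega, h, ← hi₂] at this
    have := hinj _ _ hi₂N (by omega) this; omega
  have h₂' : ∀ i < N - (i₂ - i₁), cornerOrbit (E.bcBondConfig ω') c₀ i ≠ cornerPartner d := by
    intro i hi h
    by_cases hii : i ≤ i₁
    · rw [hpre i hii, ← hi₂] at h
      have := hinj _ _ (by omega) hi₂N h; omega
    · have hs := hshift (i - i₁ - 1) (by omega)
      rw [show i₁ + 1 + (i - i₁ - 1) = i by omega] at hs
      rw [hs, ← hi₂] at h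
      have := hinj _ _ (by omega) hi₂N h; omega
  have hi₁' : cornerOrbit (E.bcBondConfig ω') c₀ i₁ = d := (hpre i₁ le_rfl).trans hi₁
  have hi₁N' : i₁ < N - (i₂ - i₁) := by omega
  have hT := hH ω' (N - (i₂ - i₁)) i₁ (i₂ - i₁) hN'' hlt'' hi₁' hi₁N' h₂' (by omega) hQ' hQmin'
  have key := pairSum_of_core_arcA φ hφ hI1 hI2 E hE ω' ω c₀ d (N - (i₂ - i₁)) N i₁ (i₂ - i₁) hc₀
    (fun e he => (hagree e he).symm) (fun h => hdiff h.symm) hp₂f hyB hN'' hlt'' hN hlt hi₁' hi₁N' h₂' (by omega) hQ'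
    hQmin' hT
  linear_combination key

/-! ## The pair identity -/

/-- **The pair identity of the vertex relation at an edge with possibly one wired-arc endpoint**
(`vertexRelation_pairSum` of the tree with "all faces at both endpoints of `e` inner" weakened to "both faces of
`e` inner and no endpoint of `e` on the free arc `B`"). Admissible data, start corner `c₀`, an edge `e = cTgt p`;
two configurations `ω`, `ω'` whose completions agree off `e` and differ at `e`, with exit times `N`, `N'`;
`φ : ℤ → ℂ` multiplicative with the two identities of `e^{−iπ/6}`; and the turning numbers `4 · turnSign` of the
loops through the partners of the darts arriving at `e` (hypothesis, for every configuration). Then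
`Φ(ω) + Φ(ω') = 0` for the defect `Φ(ω) = OPS(oX) − OPS(oY) − i (OPS(p₂) − OPS(p))` (`χ = +i`). In case 0
(neither corner of `e` a dart) the start corner is separated from the two corners leaving `e` because its source
edge `e_a` ends on `B` while `e` does not touch `B`. -/
theorem vertexRelation_pairSum_arcA : ∀ (φ : ℤ → ℂ), (∀ m n, φ (m + n) = φ m * φ n) → 2 * φ 1 - φ (-1) = Complex.I * (φ 2 - 2) → φ 1 - 2 * φ (-1) = Complex.I * (φ (-2) - 2) → ∀ (E : DiscreteDobrushin), E.IsZdAdmissible → ∀ (ω ω' : BondConfig (Site 2)) (c₀ p : Site 2 × Fin 4) (N N' : ℕ), E.IsStartCorner c₀ → (∀ e', e' ≠ cTgt p → (e' ∈ E.bcBondConfig ω' ↔ e' ∈ E.bcBondConfig ω)) → ¬ (cTgt p ∈ E.bcBondConfig ω' ↔ cTgt p ∈ E.bcBondConfig ω) → E.IsInnerFace (cFace p) → E.IsInnerFace (cFace (cornerPartner p)) → (∀ y ∈ cTgt p, y ∉ E.zdArcB) → ¬ E.IsInnerFace (cFace (cornerOrbit (E.bcBondConfig ω) c₀ N)) → (∀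 k < N, E.IsInnerFace (cFace (cornerOrbit (E.bcBondConfig ω) c₀ k))) → ¬ E.IsInnerFace (cFace (cornerOrbit (E.bcBondConfig ω') c₀ N')) → (∀ k < N', E.IsInnerFace (cFace (cornerOrbit (E.bcBondConfig ω') c₀ k))) → (∀ (ω₁ : BondConfig (Site 2)) (p₁ : Site 2 × Fin 4) (N₁ i₁ Q : ℕ), cTgt p₁ = cTgt p → ¬ E.IsInnerFace (cFace (cornerOrbit (E.bcBondConfig ω₁) c₀ N₁)) → (∀ k < N₁, E.IsInnerFace (cFace (cornerOrbit (E.bcBondConfig ω₁) c₀ k))) → cornerOrbit (E.bcBondConfig ω₁) c₀ i₁ = p₁ → i₁ < N₁ → (∀ i < N₁, cornerOrbit (E.bcBondConfig ω₁) c₀ i ≠ cornerPartner p₁) → E.IsInnerFace (cFace (cornerPartner p₁)) → p₁.1 + cornerUnit (p₁.2 + 1) ∉ E.zdArcB → 0 < Q → cornerOrbit (E.bcBondConfig ω₁) (cornerPartner p₁) Q = cornerPartner p₁ → (∀ s, 0 < s → s < Q → cornerOrbit (E.bcBondConfig ω₁) (cornerPartner p₁) s ≠ cornerPartner p₁) →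 ∑ m ∈ Finset.range Q, turnSign (E.bcBondConfig ω₁) (cornerOrbit (E.bcBondConfig ω₁) (cornerPartner p₁) m) = 4 * turnSign (E.bcBondConfig ω₁) p₁) → ((∑ j ∈ (Finset.range N).filter (fun j => cornerOrbit (E.bcBondConfig ω) c₀ j = (p.1, p.2 + 1)), φ (turnCount (E.bcBondConfig ω) c₀ j)) - (∑ j ∈ (Finset.range N).filter (fun j => cornerOrbit (E.bcBondConfig ω) c₀ j = (p.1 + cornerUnit (p.2 + 1), p.2 + 3)), φ (turnCount (E.bcBondConfig ω) c₀ j)) - Complex.I * ((∑ j ∈ (Finset.range N).filter (fun j => cornerOrbit (E.bcBondConfig ω) c₀ j = cornerPartner p), φ (turnCount (E.bcBondConfig ω) c₀ j)) - (∑ j ∈ (Finset.range N).filter (fun j => cornerOrbit (E.bcBondConfig ω) c₀ j = p), φ (turnCount (E.bcBondConfig ω) c₀ j)))) + ((∑ j ∈ (Finset.range N').filter (fun j => cornerOrbit (E.bcBondConfig ω') c₀ j = (p.1, p.2 + 1)), φ (turnCount (E.bcBondConfig ω') c₀ j)) - (∑ j ∈ (Finset.range N').filter (fun j => cornerOrbit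 (E.bcBondConfig ω') c₀ j = (p.1 + cornerUnit (p.2 + 1), p.2 + 3)), φ (turnCount (E.bcBondConfig ω') c₀ j)) - Complex.I * ((∑ j ∈ (Finset.range N').filter (fun j => cornerOrbit (E.bcBondConfig ω') c₀ j = cornerPartner p), φ (turnCount (E.bcBondConfig ω') c₀ j)) - (∑ j ∈ (Finset.range N').filter (fun j => cornerOrbit (E.bcBondConfig ω') c₀ j = p), φ (turnCount (E.bcBondConfig ω') c₀ j)))) = 0 := by
  intro φ hφ hI1 hI2 E hE ω ω' c₀ p N N' hc₀ hagree hdiff hpf hp₂f hB hN hlt hN' hlt' hH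
  classical
  -- the partner and the two outgoing corners
  have hp₂x : (cornerPartner p).1 + cornerUnit ((cornerPartner p).2 + 1) = p.1 := congrArg Prod.fst (partner_Y p)
  have hxB : p.1 ∉ E.zdArcB := hB p.1 (Sym2.mem_mk_left _ _)
  have hyB : p.1 + cornerUnit (p.2 + 1) ∉ E.zdArcB := hB _ (Sym2.mem_mk_right _ _)
  have hy' : E.IsInnerFace (cFace (cornerPartner (cornerPartner p))) := by rw [partner_partner]; exact hpf
  have hxB' : (cornerPartner p).1 + cornerUnit ((cornerPartner p).2 + 1) ∉ E.zdArcB := by rw [hp₂x]; exact hxB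
  have hHp : (∀ (ω₁ : BondConfig (Site 2)) (N₁ i₁ Q : ℕ), ¬ E.IsInnerFace (cFace (cornerOrbit (E.bcBondConfig ω₁) c₀ N₁)) → (∀ k < N₁, E.IsInnerFace (cFace (cornerOrbit (E.bcBondConfig ω₁) c₀ k))) → cornerOrbit (E.bcBondConfig ω₁) c₀ i₁ = p → i₁ < N₁ → (∀ i < N₁, cornerOrbit (E.bcBondConfig ω₁) c₀ i ≠ cornerPartner p) → 0 < Q → cornerOrbit (E.bcBondConfig ω₁) (cornerPartner p) Q = cornerPartner p → (∀ s, 0 < s → s < Q → cornerOrbit (E.bcBondConfig ω₁) (cornerPartner p) s ≠ cornerPartner p) → ∑ m ∈ Finset.range Q, turnSign (E.bcBondConfig ω₁) (cornerOrbit (E.bcBondConfig ω₁) (cornerPartner p) m) = 4 * turnSign (E.bcBondConfig ω₁) p) := fun ω₁ N₁ i₁ Q a b c d' e f g h => hH ω₁ p N₁ i₁ Q rfl a b c d' e hp₂f hyB f g h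
  have hHp₂ : (∀ (ω₁ : BondConfig (Site 2)) (N₁ i₁ Q : ℕ), ¬ E.IsInnerFace (cFace (cornerOrbit (E.bcBondConfig ω₁) c₀ N₁)) → (∀ k < N₁, E.IsInnerFace (cFace (cornerOrbit (E.bcBondConfig ω₁) c₀ k))) → cornerOrbit (E.bcBondConfig ω₁) c₀ i₁ = (cornerPartner p) → i₁ < N₁ → (∀ i < N₁, cornerOrbit (E.bcBondConfig ω₁) c₀ i ≠ cornerPartner (cornerPartner p)) → 0 < Q → cornerOrbit (E.bcBondConfig ω₁) (cornerPartner (cornerPartner p)) Q = cornerPartner (cornerPartner p) → (∀ s, 0 < s → s < Q → cornerOrbit (E.bcBondConfig ω₁) (cornerPartner (cornerPartner p)) s ≠ cornerPartner (cornerPartner p)) → ∑ m ∈ Finset.range Q, turnSign (E.bcBondConfig ω₁) (cornerOrbit (E.bcBondConfig ω₁) (cornerPartner (cornerPartner p)) m) = 4 * turnSign (E.bcBondConfig ω₁) (cornerPartner p)) := fun ω₁ N₁ i₁ Q a b c d' e f g h =>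
    hH ω₁ (cornerPartner p) N₁ i₁ Q (cTgt_partner p) a b c d' e hy' hxB' f g h
  have hagree₂ : ∀ e', e' ≠ cTgt (cornerPartner p) → (e' ∈ E.bcBondConfig ω' ↔ e' ∈ E.bcBondConfig ω) := by
    rw [cTgt_partner]; exact hagree
  have hdiff₂ : ¬ (cTgt (cornerPartner p) ∈ E.bcBondConfig ω' ↔ cTgt (cornerPartner p) ∈ E.bcBondConfig ω) := by
    rw [cTgt_partner]; exact hdiff
  by_cases hp : ∃ i₁ < N, cornerOrbit (E.bcBondConfig ω) c₀ i₁ = p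
  · obtain ⟨i₁, hi₁N, hi₁⟩ := hp
    by_cases hp₂ : ∃ i₂ < N, cornerOrbit (E.bcBondConfig ω) c₀ i₂ = cornerPartner p
    · obtain ⟨i₂, hi₂N, hi₂⟩ := hp₂
      have hne : i₁ ≠ i₂ := by
        rintro rfl
        exact partner_ne p (hi₂.symm.trans hi₁)
      rcases Nat.lt_or_gt_of_ne hne with h12 | h21
      · have key := pairSum_case2_arcA φ hφ hI1 hI2 E hE ω ω' c₀ p N N' i₁ i₂ hc₀ hagree hdiff hp₂f hyB hN hlt hN' hlt'
          hi₁ hi₂ h12 hi₂N hHp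
        linear_combination key
      · have key := pairSum_case2_arcA φ hφ hI1 hI2 E hE ω ω' c₀ (cornerPartner p) N N' i₂ i₁ hc₀ hagree₂ hdiff₂ hy' hxB'
          hN hlt hN' hlt' hi₂ (by rw [partner_partner]; exact hi₁) h21 hi₁N hHp₂
        rw [partner_X, partner_Y, partner_partner] at key
        linear_combination -key
    · push Not at hp₂
      have key := pairSum_case1_arcA φ hφ hI1 hI2 E hE ω ω' c₀ p N N' i₁ hc₀ hagree hdiff hp₂f hyB hN hlt hN' hlt' hi₁ hi₁N
        hp₂ hHp
      linear_combination key
  · push Not at hp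
    by_cases hp₂ : ∃ i₂ < N, cornerOrbit (E.bcBondConfig ω) c₀ i₂ = cornerPartner p
    · obtain ⟨i₂, hi₂N, hi₂⟩ := hp₂
      have key := pairSum_case1_arcA φ hφ hI1 hI2 E hE ω ω' c₀ (cornerPartner p) N N' i₂ hc₀ hagree₂ hdiff₂ hy' hxB' hN hlt
        hN' hlt' hi₂ hi₂N (by rw [partner_partner]; exact hp) hHp₂
      rw [partner_X, partner_Y, partner_partner] at key
      linear_combination -key
    · push Not at hp₂
      -- neither corner of `e` is a dart: the two paths coincide and all eight sums vanish
      have h0 := cornerOrbit_toggle_case0 hagree hdiff (N := N) hp hp₂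
      obtain rfl : N' = N := exit_unique hN' hlt' (by rw [h0 N le_rfl]; exact hN)
        (fun k hk => by rw [h0 k hk.le]; exact hlt k hk)
      have hp' : ∀ j < N', cornerOrbit (E.bcBondConfig ω') c₀ j ≠ p := fun j hj => by
        rw [h0 j hj.le]; exact hp j hj
      have hp₂' : ∀ j < N', cornerOrbit (E.bcBondConfig ω') c₀ j ≠ cornerPartner p := fun j hj => by
        rw [h0 j hj.le]; exact hp₂ j hj
      have hsX : cSrc (p.1, p.2 + 1) = cTgt p := rfl
      have hsY : cSrc (p.1 + cornerUnit (p.2 + 1), p.2 + 3) = cTgt p := by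
        rw [← nextCorner_of_mem (Set.mem_univ (cTgt p)), cSrc_nextCorner]
      -- the start corner's source edge `e_a` ends on `B`, the endpoints of `e` are off `B`
      have hc₀X : c₀ ≠ (p.1, p.2 + 1) := fun h =>
        hB (c₀.1 + cornerUnit c₀.2) (by rw [← hsX, h]; exact Sym2.mem_mk_right _ _) hc₀.mem_zdArcB
      have hc₀Y : c₀ ≠ (p.1 + cornerUnit (p.2 + 1), p.2 + 3) := fun h =>
        hB (c₀.1 + cornerUnit c₀.2) (by rw [← hsY, h]; exact Sym2.mem_mk_right _ _) hc₀.mem_zdArcB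
      have z : ∀ (ω₁ : BondConfig (Site 2)) (q : Site 2 × Fin 4), (∀ j < N', cornerOrbit (E.bcBondConfig ω₁) c₀ j ≠ q) →
          (∑ j ∈ (Finset.range N').filter (fun j => cornerOrbit (E.bcBondConfig ω₁) c₀ j = q),
            φ (turnCount (E.bcBondConfig ω₁) c₀ j)) = 0 :=
        fun ω₁ q h => sum_filter_eq_zero_of_forall_not _ _ _ fun j hj => h j (Finset.mem_range.1 hj)
      rw [z ω _ (forall_ne_of_out hsX hc₀X hp hp₂), z ω _ (forall_ne_of_out hsY hc₀Y hp hp₂), z ω _ hp₂, z ω _ hp,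
        z ω' _ (forall_ne_of_out hsX hc₀X hp' hp₂'), z ω' _ (forall_ne_of_out hsY hc₀Y hp' hp₂'), z ω' _ hp₂', z ω' _ hp']
      simp

/-! ## The relation in expectation -/

/-- **Pointwise pair identity at an edge with possibly one wired-arc endpoint.** Jordan data, admissible;
`e = cTgt p` an edge of `Ω_δ` with no endpoint on `B` and not both endpoints on `A`, whose two faces are inner.
For every configuration `ω`, the defect `Φ(ω) = F(oX) − F(oY) − i (F(p₂) − F(p))` of the vertex relation
(spin-`1/3` phase sums of the exploration path at the four corners at `e`) satisfies `Φ(ω △ {e}) = −Φ(ω)`. -/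
theorem dartPhaseSum_pair_arcA (D : DobrushinDomain) {E : DiscreteDobrushin} (hΩ : E.Ω = D.carrier)
    (hE : E.IsZdAdmissible) {p : Site 2 × Fin 4} (he : cTgt p ∈ (discreteDomainGraph E.Ω E.δ).edgeSet)
    (hB : ∀ y ∈ cTgt p, y ∉ E.zdArcB) (hA : ∃ y ∈ cTgt p, y ∉ E.zdArcA) (hin₁ : E.IsInnerFace (cFace p))
    (hin₂ : E.IsInnerFace (faceAt p.1 (p.2 + 1))) (ω : BondConfig (Site 2)) :
    (dartPhaseSum (medialExploration E (symmDiff ω {cTgt p})) E.δ (1 / 3) (p.1, cFace (p.1, p.2 + 1)) -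
        dartPhaseSum (medialExploration E (symmDiff ω {cTgt p})) E.δ (1 / 3)
          (p.1 + cornerUnit (p.2 + 1), cFace (p.1 + cornerUnit (p.2 + 1), p.2 + 3)) -
        Complex.I * (dartPhaseSum (medialExploration E (symmDiff ω {cTgt p})) E.δ (1 / 3)
            ((cornerPartner p).1, cFace (cornerPartner p)) -
          dartPhaseSum (medialExploration E (symmDiff ω {cTgt p})) E.δ (1 / 3) (p.1, cFace p))) =
      -(dartPhaseSum (medialExploration E ω) E.δ (1 / 3) (p.1, cFace (p.1, p.2 + 1)) -
        dartPhaseSum (medialExploration E ω) E.δ (1 / 3)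
          (p.1 + cornerUnit (p.2 + 1), cFace (p.1 + cornerUnit (p.2 + 1), p.2 + 3)) -
        Complex.I * (dartPhaseSum (medialExploration E ω) E.δ (1 / 3) ((cornerPartner p).1, cFace (cornerPartner p)) -
          dartPhaseSum (medialExploration E ω) E.δ (1 / 3) (p.1, cFace p))) := by
  -- the two faces of `e` are inner (the partner's face is the second one)
  have hin₂' : E.IsInnerFace (cFace (cornerPartner p)) := by
    show E.IsInnerFace (faceAt (p.1 + cornerUnit (p.2 + 1)) (p.2 + 2))
    rw [← fin4_add_one_add_one, faceAt_add_unit_succ]; exact hin₂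
  -- `e` is a fair coin: the completions agree off `e` and differ at `e`
  have hbc : ∀ ω₁ : BondConfig (Site 2), cTgt p ∈ E.bcBondConfig ω₁ ↔ cTgt p ∈ ω₁ := by
    intro ω₁
    rw [DiscreteDobrushin.mem_bcBondConfig_iff]
    constructor
    · rintro ⟨-, h | ⟨h, -⟩⟩
      · obtain ⟨y, hy, hyA⟩ := hA
        exact absurd (h y hy) hyA
      · exact h
    · intro h
      exact ⟨he, Or.inr ⟨h, hB⟩⟩
  have hagree : ∀ e', e' ≠ cTgt p → (e' ∈ E.bcBondConfig (symmDiff ω {cTgt p}) ↔ e' ∈ E.bcBondConfig ω) := by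
    intro e' he'
    simp only [DiscreteDobrushin.mem_bcBondConfig_iff, Set.mem_symmDiff, Set.mem_singleton_iff, he', not_false_eq_true,
      and_true, false_and, or_false]
  have hdiff : ¬ (cTgt p ∈ E.bcBondConfig (symmDiff ω {cTgt p}) ↔ cTgt p ∈ E.bcBondConfig ω) := by
    rw [hbc, hbc, Set.mem_symmDiff]
    simp
  -- the orbit form of the eight phase sums
  rw [show (p.1, cFace (p.1, p.2 + 1)) = ((p.1, p.2 + 1).1, cFace (p.1, p.2 + 1)) from rfl,
    show (p.1 + cornerUnit (p.2 + 1), cFace (p.1 + cornerUnit (p.2 + 1), p.2 + 3)) =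
      ((p.1 + cornerUnit (p.2 + 1), p.2 + 3).1, cFace (p.1 + cornerUnit (p.2 + 1), p.2 + 3)) from rfl]
  rw [dartPhaseSum_eq_orbitSum hE (symmDiff ω {cTgt p}) (p.1, p.2 + 1),
    dartPhaseSum_eq_orbitSum hE (symmDiff ω {cTgt p}) (p.1 + cornerUnit (p.2 + 1), p.2 + 3),
    dartPhaseSum_eq_orbitSum hE (symmDiff ω {cTgt p}) (cornerPartner p), dartPhaseSum_eq_orbitSum hE (symmDiff ω {cTgt p}) p,
    dartPhaseSum_eq_orbitSum hE ω (p.1, p.2 + 1), dartPhaseSum_eq_orbitSum hE ω (p.1 + cornerUnit (p.2 + 1), p.2 + 3),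
    dartPhaseSum_eq_orbitSum hE ω (cornerPartner p), dartPhaseSum_eq_orbitSum hE ω p]
  have key := vertexRelation_pairSum_arcA (fun m : ℤ => Complex.exp (-(Real.pi / 6 * (m : ℂ)) * Complex.I)) twelfth_add
    twelfth_identities.1 twelfth_identities.2 E hE ω (symmDiff ω {cTgt p}) (DiscreteDobrushin.startCorner hE) p
    (DiscreteDobrushin.exitTime hE ω) (DiscreteDobrushin.exitTime hE (symmDiff ω {cTgt p}))
    (DiscreteDobrushin.isStartCorner_startCorner hE) hagree hdiff hin₁ hin₂' hB
    (DiscreteDobrushin.not_isInnerFace_exitTime hE ω) (fun k hk => DiscreteDobrushin.isInnerFace_of_lt_exitTime hE ω hk)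
    (DiscreteDobrushin.not_isInnerFace_exitTime hE _) (fun k hk => DiscreteDobrushin.isInnerFace_of_lt_exitTime hE _ hk)
    (fun ω₁ p₁ N₁ i₁ Q _ a b c d e f f' g h i =>
      spliceLoop_turning_eq_arcA D E hΩ hE ω₁ (DiscreteDobrushin.startCorner hE) p₁ N₁ i₁ Q
        (DiscreteDobrushin.isStartCorner_startCorner hE) a b c d e f f' g h i)
  beta_reduce at key
  linear_combination key

/-- **The vertex relation for the corner observable at an edge with possibly one wired-arc endpoint**
(`cornerObs_vertexRelation` of the tree under the weak hypotheses): Jordan data, admissible, `e = cTgt p` an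
edge of `Ω_δ` with no endpoint on `B`, not both endpoints on `A`, both faces inner. Then
`E(oX) − E(oY) = i (E(p₂) − E(p))` for the two corners `oX = (p.1, p.2+1)`, `oY = (p.1 + u, p.2+3)` leaving
`e` and the two corners `p`, `p₂ = cornerPartner p` arriving at it: the defect is integrable and odd under the
`P_{1/2}`-preserving involution `ω ↦ ω △ {e}` (`dartPhaseSum_pair_arcA`, `bondPercolation_half_map_symmDiff`). -/
theorem cornerObs_vertexRelation_arcA (D : DobrushinDomain) {E : DiscreteDobrushin} (hΩ : E.Ω = D.carrier)
    (hE : E.IsZdAdmissible) {p : Site 2 × Fin 4} (he : cTgt p ∈ (discreteDomainGraph E.Ω E.δ).edgeSet)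
    (hB : ∀ y ∈ cTgt p, y ∉ E.zdArcB) (hA : ∃ y ∈ cTgt p, y ∉ E.zdArcA) (hin₁ : E.IsInnerFace (cFace p))
    (hin₂ : E.IsInnerFace (faceAt p.1 (p.2 + 1))) :
    cornerObs E E.δ p.1 (cFace (p.1, p.2 + 1)) -
        cornerObs E E.δ (p.1 + cornerUnit (p.2 + 1)) (cFace (p.1 + cornerUnit (p.2 + 1), p.2 + 3)) =
      Complex.I * (cornerObs E E.δ (cornerPartner p).1 (cFace (cornerPartner p)) - cornerObs E E.δ p.1 (cFace p)) := by
  simp only [cornerObs_eq_integral_dartPhaseSum]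
  set P := bondPercolation (zdGraph 2) half with hP
  set Φ : BondConfig (Site 2) → ℂ := fun ω =>
    dartPhaseSum (medialExploration E ω) E.δ (1 / 3) (p.1, cFace (p.1, p.2 + 1)) -
      dartPhaseSum (medialExploration E ω) E.δ (1 / 3) (p.1 + cornerUnit (p.2 + 1), cFace (p.1 + cornerUnit (p.2 + 1), p.2 + 3)) -
      Complex.I * (dartPhaseSum (medialExploration E ω) E.δ (1 / 3) ((cornerPartner p).1, cFace (cornerPartner p)) -
        dartPhaseSum (medialExploration E ω) E.δ (1 / 3) (p.1, cFace p)) with hΦ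
  have hint : ∀ c : Site 2 × Site 2, Integrable (fun ω => dartPhaseSum (medialExploration E ω) E.δ (1 / 3) c) P :=
    fun c => integrable_dartPhaseSum_medialExploration hE E.δ (1 / 3) c
  have hΦint : Integrable Φ P := ((hint _).sub (hint _)).sub (((hint _).sub (hint _)).const_mul Complex.I)
  have hτ : ∀ ω, Φ (symmDiff ω {cTgt p}) = -Φ ω := fun ω => dartPhaseSum_pair_arcA D hΩ hE he hB hA hin₁ hin₂ ω
  have hmap : P.map (fun ω => symmDiff ω {cTgt p}) = P := bondPercolation_half_map_symmDiff (cTgt_mem_edgeSet p)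
  have hzero : ∫ ω, Φ ω ∂P = 0 := by
    have h1 : ∫ ω, Φ ω ∂P = ∫ ω, Φ (symmDiff ω {cTgt p}) ∂P := by
      conv_lhs => rw [← hmap]
      exact integral_map (measurable_symmDiff_singleton _).aemeasurable (by rw [hmap]; exact hΦint.aestronglyMeasurable)
    rw [show (fun ω => Φ (symmDiff ω {cTgt p})) = fun ω => -Φ ω from funext hτ, integral_neg] at h1
    linear_combination (1 / 2 : ℂ) * h1
  have hexp : ∫ ω, Φ ω ∂P =
      (∫ ω, dartPhaseSum (medialExploration E ω) E.δ (1 / 3) (p.1, cFace (p.1, p.2 + 1)) ∂P) -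
        (∫ ω, dartPhaseSum (medialExploration E ω) E.δ (1 / 3)
          (p.1 + cornerUnit (p.2 + 1), cFace (p.1 + cornerUnit (p.2 + 1), p.2 + 3)) ∂P) -
        Complex.I * ((∫ ω, dartPhaseSum (medialExploration E ω) E.δ (1 / 3) ((cornerPartner p).1, cFace (cornerPartner p)) ∂P) -
          (∫ ω, dartPhaseSum (medialExploration E ω) E.δ (1 / 3) (p.1, cFace p) ∂P)) := by
    have i1 := hint (p.1, cFace (p.1, p.2 + 1))
    have i2 := hint (p.1 + cornerUnit (p.2 + 1), cFace (p.1 + cornerUnit (p.2 + 1), p.2 + 3))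
    have i3 := hint ((cornerPartner p).1, cFace (cornerPartner p))
    have i4 := hint (p.1, cFace p)
    have i12 : Integrable (fun ω => dartPhaseSum (medialExploration E ω) E.δ (1 / 3) (p.1, cFace (p.1, p.2 + 1)) -
        dartPhaseSum (medialExploration E ω) E.δ (1 / 3)
          (p.1 + cornerUnit (p.2 + 1), cFace (p.1 + cornerUnit (p.2 + 1), p.2 + 3))) P := i1.sub i2
    have i34 : Integrable (fun ω => Complex.I *
        (dartPhaseSum (medialExploration E ω) E.δ (1 / 3) ((cornerPartner p).1, cFace (cornerPartner p)) -
          dartPhaseSum (medialExploration E ω) E.δ (1 / 3) (p.1, cFace p))) P := (i3.sub i4).const_mul Complex.I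
    rw [hΦ]
    beta_reduce
    rw [integral_sub i12 i34, integral_sub i1 i2, integral_const_mul, integral_sub i3 i4]
  rw [hexp] at hzero
  linear_combination hzero

/-! ## The stub -/

/-- **S1v — the vertex relation at interior–wired-arc edges** (registered stub `stub_vertexRelationArcA` of the
line `potential-darboux-picard-diamond` of crux `ParafermionToSLESixFamilies`, stmt-CriticalPhenomena-11389):
`VertexRelationArcA` of `…DiamondDefs.lean`, i.e. the landed `q = 1` half-Cauchy–Riemann vertex relation
`cornerObs_vertexRelation` (`χ = i`) with "both endpoints of `e` off both arcs" weakened to "no endpoint of `e` on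
the free arc `B`, not both on the wired arc `A`" (`cornerObs_vertexRelation_arcA`; `(cornerPartner p).1 =
p.1 + cornerUnit (p.2+1)` and `cFace (cornerPartner p) = faceAt (p.1 + cornerUnit (p.2+1)) (p.2+2)` by `rfl`). -/
theorem stub_vertexRelationArcA : VertexRelationArcA := by
  intro D E hΩ hE p he hB hA hin₁ hin₂
  exact cornerObs_vertexRelation_arcA D hΩ hE he hB hA hin₁ hin₂

end Summit.CriticalPhenomena.CardyFormulaZ2.Cruxes.ParafermionToSLESixFamilies.PotentialDarbouxPicardDiamond
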